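import Summits.HodgeConjecture.HodgeConjecture.Theses.HolomorphicityRate
import Literature.AlgebraicGeometry.HodgeTheory.SupportedClassesHodgeConiveauHolds
import Summits.HodgeConjecture.HodgeConjecture.Theorems.HolomorphicityRateRateGapOfHodge
import Summits.HodgeConjecture.HodgeConjecture.Theorems.HolomorphicityRateThresholdForcesHodgeTypeOfTilt
import Summits.HodgeConjecture.HodgeConjecture.Theorems.HolomorphicityRateSuperThresholdRigidityRationalThomLine
import Summits.HodgeConjecture.HodgeConjecture.Theorems.HolomorphicityRateSuperThresholdRigidityAnalyticSupportOfAlgebraic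
import Summits.HodgeConjecture.HodgeConjecture.Theorems.HolomorphicityRateSuperThresholdRigidityHolomorphicSupportOfAnalytic
import Summits.HodgeConjecture.HodgeConjecture.Theorems.HolomorphicityRateSuperThresholdRigidityNewtonEdge
import Summits.HodgeConjecture.HodgeConjecture.Theorems.HolomorphicityRateSuperThresholdRigidityHolomorphicSupport
import HarnessLib

/-!
# Route `HolomorphicityRate`, crux `SuperThresholdRigidity` (R2, stmt-HodgeConjecture-2737): the crux follows from
# E2 and the Hodge conjecture at or below the middle — and holds outright in codimensions `1` and `n - 1`

Crux item `stmt-HodgeConjecture-2737` (`HolomorphicityRate.SuperThresholdRigidity`, "beating the threshold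
`k^{-p}` is rigid"): for `X` smooth projective of dimension `n`, `p ≤ n`, a Hodge model `A`, a smooth metric `g`,
any class `c ∈ H²ᵖ(X(ℂ); ℂ)`, `hp` rational algebraic, `m ≥ 1`, `a_k ≤ C kᵖ`, `δ > 0`, `C'`: if for infinitely many
`k` the ray class `γ_k = m•c + a_k•hp` dies off a nearly holomorphic cycle support of defect `≤ C' k^{-(p+δ)}`,
then some `γ_k` dies off a closed analytic subset all of whose regular points have codimension `≥ p`.

This file records, as helpers towards the crux (`--supports`), the lead prover's structural finding (line
`registered`, skeleton `Cruxes/SuperThresholdRigidity/Lines/birth.lean`, v7) that the "Newton–Kuranishi basin"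
stub of the line needs no Newton scheme: once `c` is of type `(p,p)` — which is exactly what the route's
threshold lemma E2 (`ThresholdForcesHodgeType`, item stmt-HodgeConjecture-10764) extracts from the
super-threshold representatives — the conclusion of R2 is the Hodge conjecture in codimension `p` applied to
the RATIONAL generator of the Thom line of the support:

* `exists_holomorphicSupport_of_mem_algebraicClasses` — an algebraic class dies off a closed subset of `X^an`
  satisfying the crux's holomorphic-support clause (GAGA, `stub_analyticSupportOfAlgebraic` p150425, and the
  structure theory of analytic sets, `stub_holomorphicSupportOfAnalytic` p151374). Unconditional.
* `mem_algebraicClasses_of_nearlyHolomorphicSupport` — a class of type `(p,p)` dying off a nearly holomorphic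
  cycle support of codimension `p ≥ 1` is algebraic, GRANTED the Hodge conjecture for rational `(p,p)` classes
  on `X` (`hHC`): the class is `e • r` with `r` rational dying off the support (`stub_rationalThomLine`
  p149559), and `r = e⁻¹ γ` is `(p,p)`.
* `hodgeFor_of_eq_one_or_succ_eq` — that hypothesis `hHC` HOLDS in the tree for `p = 1` (Lefschetz `(1,1)`,
  `lefschetzOneOne_rational_holds`) and for `p = n - 1` (hard Lefschetz down to codimension `1`,
  `HardLefschetzNFold.mem_algebraicClasses_of_lt_holds`); `hodgeFor_of_hodgeBelowMiddle` derives it in every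
  codimension `0 < p ≤ n` from the Hodge conjecture at or below the middle (`2 ≤ p ≤ n/2`, the residual open
  stub `stub_hodgeBelowMiddle` shared verbatim with the sister crux `RateGap`), and
  `hodgeFor_of_hodgeConjecture` from the summit statement.
* `newtonBelowThreshold_mid_at_of_hodgeFor` — the registered stub `stub_newtonBelowThreshold_mid` of the line,
  pointwise in `(n, p, X)`, from `hHC`; hence `newtonBelowThreshold_mid_of_hodgeBelowMiddle` (the stub VERBATIM,
  conditional on the Hodge core), `newtonBelowThreshold_mid_of_eq_one_or_succ_eq` (the stub with the extra
  hypothesis `p = 1 ∨ p + 1 = n`, UNCONDITIONAL) and `newtonBelowThreshold_mid_of_hodgeConjecture`.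
* `superThresholdRigidity_at_of_mid_at` — the line's assembly pointwise: E2 + the edge codimensions
  (`stub_newtonBelowThreshold_edge` p147113) + the mid statement at `(n, p, X)` + recognition
  (`stub_holomorphicSupportIsAnalytic` p145778) give the crux at `(n, p, X)`.
* `superThresholdRigidity_of_hodgeBelowMiddle` — **E2 ∧ HC-at-or-below-the-middle ⟹ the crux** (route decl by
  name); `superThresholdRigidity_of_hodgeConjecture` — E2 ∧ HC ⟹ the crux; and UNCONDITIONALLY IN HC:
  `superThresholdRigidity_at_of_eq_one_or_succ_eq` (the crux at every `(n, p, X)` with `p = 1` or `p = n - 1`,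
  granted E2) and `superThresholdRigidity_of_le_three` (the crux for all `n ≤ 3`, granted E2).

Consequence for the route (recorded in the crux's census): as filed, R2 ⟸ E2 ∧ HC≤middle and R1 ⟸ HC≤middle
(`rateGap_of_hodgeBelowMiddle`), while R1 ∧ R2 ⟹ HC (`closes`): both cruxes carry the same residual core, the
Hodge conjecture in codimensions `2 ≤ p ≤ n/2`, and neither forces the intended "rate" mechanism.

## References

* C. Voisin, *Hodge Theory and Complex Algebraic Geometry I* (2002), §11.1.2 (Lemma 11.13), §7.1.1, Thm. 6.25,
  Thm. 11.30. [VoisinHodgeI2002]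
* J.-P. Serre, *Géométrie algébrique et géométrie analytique* (1956), §2 n°5, §6 Prop. 3. [SerreGAGA1956]
* P. Deligne, *The Hodge conjecture* (Clay, 2000), §1. [Deligne2000]
* M. Kerr, G. Pearlstein, *An exponential history of functions with logarithmic growth* (2011), §3.1.
  [KerrPearlstein2011]
-/

noncomputable section

open scoped Manifold ContDiff Topology
open Filter Set

-- `Summit.HodgeConjecture.HodgeConjecture.Theorems` is the mandated namespace (single-conjunct summit:
-- Sub = Summit), which `linter.dupNamespace` flags on every declaration; the lakefile turns the
-- linter off tree-wide (weak option), restated here so stand-alone elaboration is warning-free too.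
set_option linter.dupNamespace false

namespace Summit.HodgeConjecture.HodgeConjecture.Theorems

open Literature.AlgebraicGeometry.HodgeTheory Literature.AlgebraicGeometry.Motives
  Literature.AlgebraicTopology.SingularHomology Literature.Geometry.Kaehler
  Summit.HodgeConjecture.HodgeConjecture.Theses.HolomorphicityRate

variable {n : ℕ} {X : Literature.AlgebraicGeometry.Motives.SchemeOver ℂ}

/-! ### Algebraic classes are carried by holomorphic supports -/

/-- **An algebraic class dies off a holomorphic support.** For `X` smooth projective of dimension `n`, a Hodge
model `A`, and `γ ∈ algebraicClasses X p`, there are closed `S ⊇ Sg` in `X^an` satisfying the crux's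
holomorphic-support clause (`S` analytic near `Sg`, `Sg` inside a closed analytic set with regular points of
codimension `≥ p + 1`, real `C¹` submersion charts with `J`-invariant kernel off `Sg`) with `A^* γ` dying off
`S`: GAGA makes `γ` analytically supported in codimension `≥ p` (`stub_analyticSupportOfAlgebraic`), and a closed
analytic subset with regular points of codimension `≥ p` is a holomorphic support
(`stub_holomorphicSupportOfAnalytic`). [cite: SerreGAGA1956, §2 n°5 Lemme 1 b) and §6 Prop. 3 Cor. 2–3]
[cite: Chirka1989, §2.3 and §5.2 Thm. 1–2] -/
theorem exists_holomorphicSupport_of_mem_algebraicClasses (hX : IsSmoothProjective n X) (A : HodgeModel n X)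
    (p : ℕ) {γ : complexBetti X (2 * p)} (hγ : γ ∈ algebraicClasses X p) :
    ∃ S Sg : Set A.carrier, (IsClosed S ∧ IsClosed Sg ∧ Sg ⊆ S ∧ (∀ x ∈ Sg, Literature.Geometry.Kaehler.IsAnalyticSetAt 𝓘(ℂ, A.model) S x) ∧ (∃ T : Set A.carrier, Sg ⊆ T ∧ (Literature.Geometry.Kaehler.IsAnalyticSet 𝓘(ℂ, A.model) T ∧ ∀ x ∈ Literature.Geometry.Kaehler.regularLocus 𝓘(ℂ, A.model) T, ∀ q : ℕ, Literature.Geometry.Kaehler.IsRegularPointOfCodim 𝓘(ℂ, A.model) T q x → p + 1 ≤ q)) ∧ (∀ x ∈ S \ Sg, ∃ U : Set A.carrier, IsOpen U ∧ x ∈ U ∧ ∃ f : A.carrier → (Fin (2 * p) → ℝ), ContMDiffOn 𝓘(ℝ, A.model) 𝓘(ℝ, Fin (2 * p) → ℝ) 1 f U ∧ S ∩ U = U ∩ f ⁻¹' {0} ∧ Function.Surjective (mfderiv 𝓘(ℝ, A.model) 𝓘(ℝ, Fin (2 * p) → ℝ) f x) ∧ ∀ v : TangentSpace 𝓘(ℝ,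 A.model) x, mfderiv 𝓘(ℝ, A.model) 𝓘(ℝ, Fin (2 * p) → ℝ) f x v = 0 → mfderiv 𝓘(ℝ, A.model) 𝓘(ℝ, Fin (2 * p) → ℝ) f x (Literature.Geometry.Kaehler.tangentJ A.model x v) = 0)) ∧ Literature.AlgebraicTopology.SingularHomology.singularCohomology.map ℂ ℂ (⟨Subtype.val, continuous_subtype_val⟩ : C({x : A.carrier // x ∉ S}, A.carrier)) (2 * p) (A.pullback (2 * p) γ) = 0 := by
  obtain ⟨S, ⟨hSan, hScodim⟩, hSsupp⟩ := stub_analyticSupportOfAlgebraic n p X hX A γ hγ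
  obtain ⟨Sg, hhol⟩ := stub_holomorphicSupportOfAnalytic n X A p S hSan hScodim
  exact ⟨S, Sg, hhol, hSsupp⟩

/-! ### A `(p,p)` class carried by a nearly holomorphic cycle support is algebraic, granted HC in codimension `p` -/

/-- **A class of type `(p,p)` dying off a nearly holomorphic cycle support is algebraic, granted the Hodge
conjecture for rational `(p,p)` classes of codimension `p` on `X`** (`hHC`, in the Hodge model `A`). By the
rational Thom line (`stub_rationalThomLine`), `γ = e • r` with `r` rational and dying off the support; if
`γ = 0` it is algebraic; otherwise `e ≠ 0`, `r = e⁻¹ • γ` is of type `(p,p)`, hence algebraic by `hHC`, and so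
is `γ`. [cite: VoisinHodgeI2002, §11.1.2 Lemma 11.13 and §7.1.1] -/
theorem mem_algebraicClasses_of_nearlyHolomorphicSupport (hX : IsSmoothProjective n X) {p : ℕ} (hp0 : 0 < p)
    (A : HodgeModel n X)
    (g : Bundle.ContMDiffRiemannianMetric 𝓘(ℝ, A.model) ((⊤ : ℕ∞) : WithTop ℕ∞) A.model (fun x : A.carrier => TangentSpace 𝓘(ℝ, A.model) x))
    {t : ℝ} {S Sg : Set A.carrier} (hS : IsNearlyHolomorphicCycleSupport g.toRiemannianMetric p t S Sg)
    (hHC : ∀ r : complexBetti X (2 * p), IsRationalClass r → A.pullback (2 * p) r ∈ A.hodgePQ (2 * p) p p →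
      r ∈ algebraicClasses X p)
    {γ : complexBetti X (2 * p)} (hγpp : A.pullback (2 * p) γ ∈ A.hodgePQ (2 * p) p p)
    (hsupp : Literature.AlgebraicTopology.SingularHomology.singularCohomology.map ℂ ℂ (⟨Subtype.val, continuous_subtype_val⟩ : C({x : A.carrier // x ∉ S}, A.carrier)) (2 * p) (A.pullback (2 * p) γ) = 0) :
    γ ∈ algebraicClasses X p := by
  obtain ⟨r, hrat, _hr0, hline⟩ := stub_rationalThomLine n X hX A g p t S Sg hp0 hS
  obtain ⟨e, he⟩ := hline γ hsupp
  by_cases hγ : γ = 0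
  · rw [hγ]
    exact Submodule.zero_mem _
  · have he0 : e ≠ 0 := by
      rintro rfl
      rw [zero_smul] at he
      exact hγ he
    have hrpp : A.pullback (2 * p) r ∈ A.hodgePQ (2 * p) p p := by
      have h1 : r = e⁻¹ • γ := by rw [he, smul_smul, inv_mul_cancel₀ he0, one_smul]
      rw [h1, map_smul]
      exact Submodule.smul_mem _ _ hγpp
    rw [he]
    exact Submodule.smul_mem _ _ (hHC r hrat hrpp)

/-! ### Where the Hodge conjecture in codimension `p` is available -/

/-- **HC in codimension `p` on `X`, from the Hodge conjecture at or below the middle** (`2 ≤ p ≤ n/2`), for every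
`0 < p ≤ n`: Lefschetz `(1,1)`, top degree, hard Lefschetz, composed in the landed
`mem_algebraicClasses_of_hodgeBelowMiddle`. [cite: VoisinHodgeI2002, Thm. 6.25 and Thm. 11.30]
[cite: KerrPearlstein2011, §3.1] -/
theorem hodgeFor_of_hodgeBelowMiddle
    (hH : ∀ (n p : ℕ) (X : Literature.AlgebraicGeometry.Motives.SchemeOver ℂ), Literature.AlgebraicGeometry.Motives.IsSmoothProjective n X → 2 ≤ p → 2 * p ≤ n → ∀ (A : Literature.AlgebraicGeometry.HodgeTheory.HodgeModel n X) (c : Literature.AlgebraicGeometry.HodgeTheory.complexBetti X (2 * p)), Literature.AlgebraicGeometry.HodgeTheory.IsRationalClass c → A.pullback (2 * p) c ∈ A.hodgePQ (2 * p) p p → c ∈ Literature.AlgebraicGeometry.HodgeTheory.algebraicClasses X p)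
    (hX : IsSmoothProjective n X) {p : ℕ} (hpn : p ≤ n) (hp0 : 0 < p) (A : HodgeModel n X)
    (r : complexBetti X (2 * p)) (hr : IsRationalClass r) (hrpp : A.pullback (2 * p) r ∈ A.hodgePQ (2 * p) p p) :
    r ∈ algebraicClasses X p :=
  mem_algebraicClasses_of_hodgeBelowMiddle hH hX hpn hp0 A r hr hrpp

/-- **HC in codimensions `1` and `n - 1` holds** (unconditionally, in the tree): for `p = 1` this is the rational
Lefschetz `(1,1)` theorem (`lefschetzOneOne_rational_holds`); for `p + 1 = n` either `n < 2p` and hard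
Lefschetz (`HardLefschetzNFold.mem_algebraicClasses_of_lt_holds`) reduces to codimension `n - p = 1`, or
`2p ≤ n = p + 1` forces `p = 1` (as `p > 0`). [cite: VoisinHodgeI2002, Thm. 6.25 and Thm. 11.30]
[cite: KerrPearlstein2011, §3.1] -/
theorem hodgeFor_of_eq_one_or_succ_eq (hX : IsSmoothProjective n X) {p : ℕ} (hp : p = 1 ∨ p + 1 = n)
    (hp0 : 0 < p) (A : HodgeModel n X) (r : complexBetti X (2 * p)) (hr : IsRationalClass r)
    (hrpp : A.pullback (2 * p) r ∈ A.hodgePQ (2 * p) p p) : r ∈ algebraicClasses X p := by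
  have hL : ∀ c' : complexBetti X (2 * 1), IsRationalClass c' → IsOfHodgeType n X (2 * 1) 1 1 c' →
      c' ∈ algebraicClasses X 1 := fun c' hc' h11 => lefschetzOneOne_rational_holds hX c' hc' h11
  rcases hp with rfl | hpn
  · exact hL r hr ⟨A, hrpp⟩
  · by_cases h2 : n < 2 * p
    · -- above the middle: hard Lefschetz down to codimension `n - p = 1`
      have h1 : n - p = 1 := by omega
      refine HardLefschetzNFold.mem_algebraicClasses_of_lt_holds hX h2 ?_ r hr ⟨A, hrpp⟩
      rw [h1]
      exact hL
    · -- `2p ≤ n = p + 1` forces `p = 1`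
      have hp1 : p = 1 := by omega
      subst hp1
      exact hL r hr ⟨A, hrpp⟩

/-- **HC in codimension `p` on `X` from the summit statement** `_root_.HodgeConjecture` (its cycle conjunct at
`X`). [cite: Deligne2000, §1] -/
theorem hodgeFor_of_hodgeConjecture (hHC : _root_.HodgeConjecture) (hX : IsSmoothProjective n X) {p : ℕ}
    (A : HodgeModel n X) (r : complexBetti X (2 * p)) (hr : IsRationalClass r)
    (hrpp : A.pullback (2 * p) r ∈ A.hodgePQ (2 * p) p p) : r ∈ algebraicClasses X p :=
  (hHC hX).2 p r hr ⟨A, hrpp⟩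

/-! ### The registered stub `stub_newtonBelowThreshold_mid`, from HC in codimension `p` -/

/-- **The line's stub `stub_newtonBelowThreshold_mid` at `(n, p, X)`, granted HC for rational `(p,p)` classes of
codimension `p` on `X`** (`hHC`, in every Hodge model). For every `k` (no defect profile is used): a ray class
`γ_k = m•c + a_k•hp` dying off a nearly holomorphic cycle support of codimension `p ≥ 1` (the route's inline
clause is `IsNearlyHolomorphicCycleSupport`, `Iff.rfl`) is of type `(p,p)` — `c` by hypothesis, `hp` because
algebraic classes are `(p,p)` (`Grothendieck1969_supportedClasses_le_hodgeConiveau_holds` through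
`pullback_mem_hodgePQ_of_mem_algebraicClasses`) — hence algebraic
(`mem_algebraicClasses_of_nearlyHolomorphicSupport`), hence dies off a holomorphic support
(`exists_holomorphicSupport_of_mem_algebraicClasses`). [cite: VoisinHodgeI2002, §11.1.2 and §11.3]
[cite: GrothendieckTopology1969, p. 300] -/
theorem newtonBelowThreshold_mid_at_of_hodgeFor (n p : ℕ) (X : Literature.AlgebraicGeometry.Motives.SchemeOver ℂ)
    (hX : Literature.AlgebraicGeometry.Motives.IsSmoothProjective n X) (hp0 : 0 < p)
    (hHC : ∀ (A : Literature.AlgebraicGeometry.HodgeTheory.HodgeModel n X) (r : Literature.AlgebraicGeometry.HodgeTheory.complexBetti X (2 * p)), Literature.AlgebraicGeometry.HodgeTheory.IsRationalClass r → A.pullback (2 * p) r ∈ A.hodgePQ (2 * p) p p → r ∈ Literature.AlgebraicGeometry.HodgeTheory.algebraicClasses X p) :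
    ∀ (A : Literature.AlgebraicGeometry.HodgeTheory.HodgeModel n X) (g : Bundle.ContMDiffRiemannianMetric 𝓘(ℝ, A.model) ((⊤ : ℕ∞) : WithTop ℕ∞) A.model (fun x : A.carrier => TangentSpace 𝓘(ℝ, A.model) x)) (c hp : Literature.AlgebraicGeometry.HodgeTheory.complexBetti X (2 * p)) (m : ℕ) (C : ℝ) (a : ℕ → ℕ) (t : ℕ → ℝ), Literature.AlgebraicGeometry.HodgeTheory.IsRationalClass hp → hp ∈ Literature.AlgebraicGeometry.HodgeTheory.algebraicClasses X p → 0 < m → (∀ k, (a k : ℝ) ≤ C * (k : ℝ) ^ p) → Filter.Tendsto (fun k : ℕ => t k * (k : ℝ) ^ p) Filter.atTop (nhds 0) → A.pullback (2 * p) c ∈ A.hodgePQ (2 * p) p p → ∀ᶠ k : ℕ in Filter.atTop, (∃ S Sg : Set A.carrier, (IsClosed S ∧ IsClosed Sg ∧ Sg ⊆ S ∧ IsConnected (S \ Sg) ∧ (∀ x ∈ Sg, Literature.Geometry.Kaehler.IsAnalyticSetAt 𝓘(ℂ, A.model) S x) ∧ (∃ T : Set A.carrier, Sg ⊆ T ∧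 (Literature.Geometry.Kaehler.IsAnalyticSet 𝓘(ℂ, A.model) T ∧ ∀ x ∈ Literature.Geometry.Kaehler.regularLocus 𝓘(ℂ, A.model) T, ∀ q : ℕ, Literature.Geometry.Kaehler.IsRegularPointOfCodim 𝓘(ℂ, A.model) T q x → p + 1 ≤ q)) ∧ (∀ x ∈ S \ Sg, ∃ U : Set A.carrier, IsOpen U ∧ x ∈ U ∧ ∃ f : A.carrier → (Fin (2 * p) → ℝ), ContMDiffOn 𝓘(ℝ, A.model) 𝓘(ℝ, Fin (2 * p) → ℝ) 1 f U ∧ S ∩ U = U ∩ f ⁻¹' {0} ∧ Function.Surjective (mfderiv 𝓘(ℝ, A.model) 𝓘(ℝ, Fin (2 * p) → ℝ) f x) ∧ ∀ v : TangentSpace 𝓘(ℝ, A.model) x, mfderiv 𝓘(ℝ, A.model) 𝓘(ℝ, Fin (2 * p) → ℝ) f x v = 0 → ∃ w : TangentSpace 𝓘(ℝ, A.model) x, mfderiv 𝓘(ℝ, A.model) 𝓘(ℝ, Fin (2 * p) → ℝ) f x w = 0 ∧ g.inner x (Literature.Geometry.Kaehler.tangentJ A.model x v - w) (Literature.Geometry.Kaehler.tangentJ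 A.model x v - w) ≤ (t k) ^ 2 * g.inner x v v)) ∧ Literature.AlgebraicTopology.SingularHomology.singularCohomology.map ℂ ℂ (⟨Subtype.val, continuous_subtype_val⟩ : C({x : A.carrier // x ∉ S}, A.carrier)) (2 * p) (A.pullback (2 * p) (((m : ℂ) • c + ((a k : ℕ) : ℂ) • hp))) = 0) → ∃ S Sg : Set A.carrier, (IsClosed S ∧ IsClosed Sg ∧ Sg ⊆ S ∧ (∀ x ∈ Sg, Literature.Geometry.Kaehler.IsAnalyticSetAt 𝓘(ℂ, A.model) S x) ∧ (∃ T : Set A.carrier, Sg ⊆ T ∧ (Literature.Geometry.Kaehler.IsAnalyticSet 𝓘(ℂ, A.model) T ∧ ∀ x ∈ Literature.Geometry.Kaehler.regularLocus 𝓘(ℂ, A.model) T, ∀ q : ℕ, Literature.Geometry.Kaehler.IsRegularPointOfCodim 𝓘(ℂ, A.model) T q x → p + 1 ≤ q)) ∧ (∀ x ∈ S \ Sg, ∃ U : Set A.carrier, IsOpen U ∧ x ∈ U ∧ ∃ f : A.carrier → (Fin (2 * p) → ℝ), ContMDiffOn 𝓘(ℝ, A.model) 𝓘(ℝ, Fin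 (2 * p) → ℝ) 1 f U ∧ S ∩ U = U ∩ f ⁻¹' {0} ∧ Function.Surjective (mfderiv 𝓘(ℝ, A.model) 𝓘(ℝ, Fin (2 * p) → ℝ) f x) ∧ ∀ v : TangentSpace 𝓘(ℝ, A.model) x, mfderiv 𝓘(ℝ, A.model) 𝓘(ℝ, Fin (2 * p) → ℝ) f x v = 0 → mfderiv 𝓘(ℝ, A.model) 𝓘(ℝ, Fin (2 * p) → ℝ) f x (Literature.Geometry.Kaehler.tangentJ A.model x v) = 0)) ∧ Literature.AlgebraicTopology.SingularHomology.singularCohomology.map ℂ ℂ (⟨Subtype.val, continuous_subtype_val⟩ : C({x : A.carrier // x ∉ S}, A.carrier)) (2 * p) (A.pullback (2 * p) (((m : ℂ) • c + ((a k : ℕ) : ℂ) • hp))) = 0 := by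
  intro A g c hp m C a t _hrat halg _hm _hbud _ht hH
  refine Filter.Eventually.of_forall fun k => ?_
  rintro ⟨S, Sg, hS, hsupp⟩
  have hS' : IsNearlyHolomorphicCycleSupport g.toRiemannianMetric p (t k) S Sg :=
    (isNearlyHolomorphicCycleSupport_toRiemannianMetric_iff g).2 hS
  have hG := Grothendieck1969_supportedClasses_le_hodgeConiveau_holds
  have hγpp : A.pullback (2 * p) ((m : ℂ) • c + ((a k : ℕ) : ℂ) • hp) ∈ A.hodgePQ (2 * p) p p := by
    rw [map_add, map_smul, map_smul]
    exact Submodule.add_mem _ (Submodule.smul_mem _ _ hH)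
      (Submodule.smul_mem _ _ (pullback_mem_hodgePQ_of_mem_algebraicClasses hG hX A halg))
  exact exists_holomorphicSupport_of_mem_algebraicClasses hX A p
    (mem_algebraicClasses_of_nearlyHolomorphicSupport hX hp0 A g hS' (hHC A) hγpp hsupp)

/-- **`stub_newtonBelowThreshold_mid` VERBATIM, conditional on the Hodge conjecture at or below the middle**
(`2 ≤ p ≤ n/2`; the one open registered stub `stub_hodgeBelowMiddle` of the line, shared with crux `RateGap`).
[cite: VoisinHodgeI2002, §11.1.2 and §11.3] [cite: KerrPearlstein2011, §3.1] -/
theorem newtonBelowThreshold_mid_of_hodgeBelowMiddle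
    (hH : ∀ (n p : ℕ) (X : Literature.AlgebraicGeometry.Motives.SchemeOver ℂ), Literature.AlgebraicGeometry.Motives.IsSmoothProjective n X → 2 ≤ p → 2 * p ≤ n → ∀ (A : Literature.AlgebraicGeometry.HodgeTheory.HodgeModel n X) (c : Literature.AlgebraicGeometry.HodgeTheory.complexBetti X (2 * p)), Literature.AlgebraicGeometry.HodgeTheory.IsRationalClass c → A.pullback (2 * p) c ∈ A.hodgePQ (2 * p) p p → c ∈ Literature.AlgebraicGeometry.HodgeTheory.algebraicClasses X p) :
    ∀ (n p : ℕ) (X : Literature.AlgebraicGeometry.Motives.SchemeOver ℂ), Literature.AlgebraicGeometry.Motives.IsSmoothProjective n X → p ≤ n → 0 < p → p < n → ∀ (A : Literature.AlgebraicGeometry.HodgeTheory.HodgeModel n X) (g : Bundle.ContMDiffRiemannianMetric 𝓘(ℝ, A.model) ((⊤ : ℕ∞) : WithTop ℕ∞) A.model (fun x : A.carrier => TangentSpace 𝓘(ℝ, A.model) x)) (c hp : Literature.AlgebraicGeometry.HodgeTheory.complexBetti X (2 * p)) (m : ℕ) (C : ℝ) (a : ℕ → ℕ) (t : ℕ → ℝ),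 Literature.AlgebraicGeometry.HodgeTheory.IsRationalClass hp → hp ∈ Literature.AlgebraicGeometry.HodgeTheory.algebraicClasses X p → 0 < m → (∀ k, (a k : ℝ) ≤ C * (k : ℝ) ^ p) → Filter.Tendsto (fun k : ℕ => t k * (k : ℝ) ^ p) Filter.atTop (nhds 0) → A.pullback (2 * p) c ∈ A.hodgePQ (2 * p) p p → ∀ᶠ k : ℕ in Filter.atTop, (∃ S Sg : Set A.carrier, (IsClosed S ∧ IsClosed Sg ∧ Sg ⊆ S ∧ IsConnected (S \ Sg) ∧ (∀ x ∈ Sg, Literature.Geometry.Kaehler.IsAnalyticSetAt 𝓘(ℂ, A.model) S x) ∧ (∃ T : Set A.carrier, Sg ⊆ T ∧ (Literature.Geometry.Kaehler.IsAnalyticSet 𝓘(ℂ, A.model) T ∧ ∀ x ∈ Literature.Geometry.Kaehler.regularLocus 𝓘(ℂ, A.model) T, ∀ q : ℕ, Literature.Geometry.Kaehler.IsRegularPointOfCodim 𝓘(ℂ, A.model) T q x → p + 1 ≤ q)) ∧ (∀ x ∈ S \ Sg, ∃ U : Set A.carrier, IsOpen U ∧ x ∈ U ∧ ∃ f : A.carrier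 → (Fin (2 * p) → ℝ), ContMDiffOn 𝓘(ℝ, A.model) 𝓘(ℝ, Fin (2 * p) → ℝ) 1 f U ∧ S ∩ U = U ∩ f ⁻¹' {0} ∧ Function.Surjective (mfderiv 𝓘(ℝ, A.model) 𝓘(ℝ, Fin (2 * p) → ℝ) f x) ∧ ∀ v : TangentSpace 𝓘(ℝ, A.model) x, mfderiv 𝓘(ℝ, A.model) 𝓘(ℝ, Fin (2 * p) → ℝ) f x v = 0 → ∃ w : TangentSpace 𝓘(ℝ, A.model) x, mfderiv 𝓘(ℝ, A.model) 𝓘(ℝ, Fin (2 * p) → ℝ) f x w = 0 ∧ g.inner x (Literature.Geometry.Kaehler.tangentJ A.model x v - w) (Literature.Geometry.Kaehler.tangentJ A.model x v - w) ≤ (t k) ^ 2 * g.inner x v v)) ∧ Literature.AlgebraicTopology.SingularHomology.singularCohomology.map ℂ ℂ (⟨Subtype.val, continuous_subtype_val⟩ : C({x : A.carrier // x ∉ S}, A.carrier)) (2 * p) (A.pullback (2 * p) (((m : ℂ) • c + ((a k : ℕ) : ℂ) • hp))) = 0) → ∃ S Sg : Set A.carrier, (IsClosed S ∧ IsClosed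 Sg ∧ Sg ⊆ S ∧ (∀ x ∈ Sg, Literature.Geometry.Kaehler.IsAnalyticSetAt 𝓘(ℂ, A.model) S x) ∧ (∃ T : Set A.carrier, Sg ⊆ T ∧ (Literature.Geometry.Kaehler.IsAnalyticSet 𝓘(ℂ, A.model) T ∧ ∀ x ∈ Literature.Geometry.Kaehler.regularLocus 𝓘(ℂ, A.model) T, ∀ q : ℕ, Literature.Geometry.Kaehler.IsRegularPointOfCodim 𝓘(ℂ, A.model) T q x → p + 1 ≤ q)) ∧ (∀ x ∈ S \ Sg, ∃ U : Set A.carrier, IsOpen U ∧ x ∈ U ∧ ∃ f : A.carrier → (Fin (2 * p) → ℝ), ContMDiffOn 𝓘(ℝ, A.model) 𝓘(ℝ, Fin (2 * p) → ℝ) 1 f U ∧ S ∩ U = U ∩ f ⁻¹' {0} ∧ Function.Surjective (mfderiv 𝓘(ℝ, A.model) 𝓘(ℝ, Fin (2 * p) → ℝ) f x) ∧ ∀ v : TangentSpace 𝓘(ℝ, A.model) x, mfderiv 𝓘(ℝ, A.model) 𝓘(ℝ, Fin (2 * p) → ℝ) f x v = 0 → mfderiv 𝓘(ℝ, A.model)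 𝓘(ℝ, Fin (2 * p) → ℝ) f x (Literature.Geometry.Kaehler.tangentJ A.model x v) = 0)) ∧ Literature.AlgebraicTopology.SingularHomology.singularCohomology.map ℂ ℂ (⟨Subtype.val, continuous_subtype_val⟩ : C({x : A.carrier // x ∉ S}, A.carrier)) (2 * p) (A.pullback (2 * p) (((m : ℂ) • c + ((a k : ℕ) : ℂ) • hp))) = 0 :=
  fun n p X hX hpn hp0 _hpn' => newtonBelowThreshold_mid_at_of_hodgeFor n p X hX hp0
    (fun A r hr hrpp => hodgeFor_of_hodgeBelowMiddle hH hX hpn hp0 A r hr hrpp)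

/-- **`stub_newtonBelowThreshold_mid` in codimensions `1` and `n - 1`, UNCONDITIONALLY**: the stub's text with the
single extra hypothesis `p = 1 ∨ p + 1 = n` after `p < n` (Lefschetz `(1,1)` and hard Lefschetz supply HC in these
codimensions, `hodgeFor_of_eq_one_or_succ_eq`). In particular the stub holds outright whenever `n ≤ 3`.
[cite: VoisinHodgeI2002, Thm. 6.25, Thm. 11.30 and §11.1.2] -/
theorem newtonBelowThreshold_mid_of_eq_one_or_succ_eq : ∀ (n p : ℕ) (X : Literature.AlgebraicGeometry.Motives.SchemeOver ℂ), Literature.AlgebraicGeometry.Motives.IsSmoothProjective n X → p ≤ n → 0 < p → p < n → (p = 1 ∨ p + 1 = n) → ∀ (A : Literature.AlgebraicGeometry.HodgeTheory.HodgeModel n X) (g : Bundle.ContMDiffRiemannianMetric 𝓘(ℝ, A.model) ((⊤ : ℕ∞) : WithTop ℕ∞) A.model (fun x : A.carrier => TangentSpace 𝓘(ℝ, A.model) x)) (c hp : Literature.AlgebraicGeometry.HodgeTheory.complexBetti X (2 * p)) (m : ℕ) (C : ℝ) (a : ℕ → ℕ) (t : ℕ → ℝ), Literature.AlgebraicGeometry.HodgeTheory.IsRationalClass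 hp → hp ∈ Literature.AlgebraicGeometry.HodgeTheory.algebraicClasses X p → 0 < m → (∀ k, (a k : ℝ) ≤ C * (k : ℝ) ^ p) → Filter.Tendsto (fun k : ℕ => t k * (k : ℝ) ^ p) Filter.atTop (nhds 0) → A.pullback (2 * p) c ∈ A.hodgePQ (2 * p) p p → ∀ᶠ k : ℕ in Filter.atTop, (∃ S Sg : Set A.carrier, (IsClosed S ∧ IsClosed Sg ∧ Sg ⊆ S ∧ IsConnected (S \ Sg) ∧ (∀ x ∈ Sg, Literature.Geometry.Kaehler.IsAnalyticSetAt 𝓘(ℂ, A.model) S x) ∧ (∃ T : Set A.carrier, Sg ⊆ T ∧ (Literature.Geometry.Kaehler.IsAnalyticSet 𝓘(ℂ, A.model) T ∧ ∀ x ∈ Literature.Geometry.Kaehler.regularLocus 𝓘(ℂ, A.model) T, ∀ q : ℕ, Literature.Geometry.Kaehler.IsRegularPointOfCodim 𝓘(ℂ, A.model) T q x → p + 1 ≤ q)) ∧ (∀ x ∈ S \ Sg, ∃ U : Set A.carrier, IsOpen U ∧ x ∈ U ∧ ∃ f : A.carrier → (Fin (2 * p) → ℝ), ContMDiffOn 𝓘(ℝ,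 A.model) 𝓘(ℝ, Fin (2 * p) → ℝ) 1 f U ∧ S ∩ U = U ∩ f ⁻¹' {0} ∧ Function.Surjective (mfderiv 𝓘(ℝ, A.model) 𝓘(ℝ, Fin (2 * p) → ℝ) f x) ∧ ∀ v : TangentSpace 𝓘(ℝ, A.model) x, mfderiv 𝓘(ℝ, A.model) 𝓘(ℝ, Fin (2 * p) → ℝ) f x v = 0 → ∃ w : TangentSpace 𝓘(ℝ, A.model) x, mfderiv 𝓘(ℝ, A.model) 𝓘(ℝ, Fin (2 * p) → ℝ) f x w = 0 ∧ g.inner x (Literature.Geometry.Kaehler.tangentJ A.model x v - w) (Literature.Geometry.Kaehler.tangentJ A.model x v - w) ≤ (t k) ^ 2 * g.inner x v v)) ∧ Literature.AlgebraicTopology.SingularHomology.singularCohomology.map ℂ ℂ (⟨Subtype.val, continuous_subtype_val⟩ : C({x : A.carrier // x ∉ S}, A.carrier)) (2 * p) (A.pullback (2 * p) (((m : ℂ) • c + ((a k : ℕ) : ℂ) • hp))) = 0) → ∃ S Sg : Set A.carrier, (IsClosed S ∧ IsClosed Sg ∧ Sg ⊆ S ∧ (∀ x ∈ Sg, Literature.Geometry.Kaehler.IsAnalyticSetAt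 𝓘(ℂ, A.model) S x) ∧ (∃ T : Set A.carrier, Sg ⊆ T ∧ (Literature.Geometry.Kaehler.IsAnalyticSet 𝓘(ℂ, A.model) T ∧ ∀ x ∈ Literature.Geometry.Kaehler.regularLocus 𝓘(ℂ, A.model) T, ∀ q : ℕ, Literature.Geometry.Kaehler.IsRegularPointOfCodim 𝓘(ℂ, A.model) T q x → p + 1 ≤ q)) ∧ (∀ x ∈ S \ Sg, ∃ U : Set A.carrier, IsOpen U ∧ x ∈ U ∧ ∃ f : A.carrier → (Fin (2 * p) → ℝ), ContMDiffOn 𝓘(ℝ, A.model) 𝓘(ℝ, Fin (2 * p) → ℝ) 1 f U ∧ S ∩ U = U ∩ f ⁻¹' {0} ∧ Function.Surjective (mfderiv 𝓘(ℝ, A.model) 𝓘(ℝ, Fin (2 * p) → ℝ) f x) ∧ ∀ v : TangentSpace 𝓘(ℝ, A.model) x, mfderiv 𝓘(ℝ, A.model) 𝓘(ℝ, Fin (2 * p) → ℝ) f x v = 0 → mfderiv 𝓘(ℝ, A.model) 𝓘(ℝ, Fin (2 * p) → ℝ) f x (Literature.Geometry.Kaehler.tangentJ A.model x v) = 0)) ∧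 Literature.AlgebraicTopology.SingularHomology.singularCohomology.map ℂ ℂ (⟨Subtype.val, continuous_subtype_val⟩ : C({x : A.carrier // x ∉ S}, A.carrier)) (2 * p) (A.pullback (2 * p) (((m : ℂ) • c + ((a k : ℕ) : ℂ) • hp))) = 0 :=
  fun n p X hX _hpn hp0 _hpn' hp => newtonBelowThreshold_mid_at_of_hodgeFor n p X hX hp0
    (fun A r hr hrpp => hodgeFor_of_eq_one_or_succ_eq hX hp hp0 A r hr hrpp)

/-- **`stub_newtonBelowThreshold_mid` VERBATIM from the summit statement** (`_root_.HodgeConjecture`): the Hodge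
conjecture implies the line's only HC-strength stub (consistency of the line; with E2 it implies the crux,
`superThresholdRigidity_of_hodgeConjecture`). [cite: Deligne2000, §1] -/
theorem newtonBelowThreshold_mid_of_hodgeConjecture (hHC : _root_.HodgeConjecture) :
    ∀ (n p : ℕ) (X : Literature.AlgebraicGeometry.Motives.SchemeOver ℂ), Literature.AlgebraicGeometry.Motives.IsSmoothProjective n X → p ≤ n → 0 < p → p < n → ∀ (A : Literature.AlgebraicGeometry.HodgeTheory.HodgeModel n X) (g : Bundle.ContMDiffRiemannianMetric 𝓘(ℝ, A.model) ((⊤ : ℕ∞) : WithTop ℕ∞) A.model (fun x : A.carrier => TangentSpace 𝓘(ℝ, A.model) x)) (c hp : Literature.AlgebraicGeometry.HodgeTheory.complexBetti X (2 * p)) (m : ℕ) (C : ℝ) (a : ℕ → ℕ) (t : ℕ → ℝ), Literature.AlgebraicGeometry.HodgeTheory.IsRationalClass hp → hp ∈ Literature.AlgebraicGeometry.HodgeTheory.algebraicClasses X p → 0 < m → (∀ k, (a k : ℝ) ≤ C * (k : ℝ) ^ p) → Filter.Tendsto (fun k : ℕ => t k * (k : ℝ) ^ p) Filter.atTop (nhds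 0) → A.pullback (2 * p) c ∈ A.hodgePQ (2 * p) p p → ∀ᶠ k : ℕ in Filter.atTop, (∃ S Sg : Set A.carrier, (IsClosed S ∧ IsClosed Sg ∧ Sg ⊆ S ∧ IsConnected (S \ Sg) ∧ (∀ x ∈ Sg, Literature.Geometry.Kaehler.IsAnalyticSetAt 𝓘(ℂ, A.model) S x) ∧ (∃ T : Set A.carrier, Sg ⊆ T ∧ (Literature.Geometry.Kaehler.IsAnalyticSet 𝓘(ℂ, A.model) T ∧ ∀ x ∈ Literature.Geometry.Kaehler.regularLocus 𝓘(ℂ, A.model) T, ∀ q : ℕ, Literature.Geometry.Kaehler.IsRegularPointOfCodim 𝓘(ℂ, A.model) T q x → p + 1 ≤ q)) ∧ (∀ x ∈ S \ Sg, ∃ U : Set A.carrier, IsOpen U ∧ x ∈ U ∧ ∃ f : A.carrier → (Fin (2 * p) → ℝ), ContMDiffOn 𝓘(ℝ, A.model) 𝓘(ℝ, Fin (2 * p) → ℝ) 1 f U ∧ S ∩ U = U ∩ f ⁻¹' {0} ∧ Function.Surjective (mfderiv 𝓘(ℝ, A.model) 𝓘(ℝ, Fin (2 * p) → ℝ) f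 x) ∧ ∀ v : TangentSpace 𝓘(ℝ, A.model) x, mfderiv 𝓘(ℝ, A.model) 𝓘(ℝ, Fin (2 * p) → ℝ) f x v = 0 → ∃ w : TangentSpace 𝓘(ℝ, A.model) x, mfderiv 𝓘(ℝ, A.model) 𝓘(ℝ, Fin (2 * p) → ℝ) f x w = 0 ∧ g.inner x (Literature.Geometry.Kaehler.tangentJ A.model x v - w) (Literature.Geometry.Kaehler.tangentJ A.model x v - w) ≤ (t k) ^ 2 * g.inner x v v)) ∧ Literature.AlgebraicTopology.SingularHomology.singularCohomology.map ℂ ℂ (⟨Subtype.val, continuous_subtype_val⟩ : C({x : A.carrier // x ∉ S}, A.carrier)) (2 * p) (A.pullback (2 * p) (((m : ℂ) • c + ((a k : ℕ) : ℂ) • hp))) = 0) → ∃ S Sg : Set A.carrier, (IsClosed S ∧ IsClosed Sg ∧ Sg ⊆ S ∧ (∀ x ∈ Sg, Literature.Geometry.Kaehler.IsAnalyticSetAt 𝓘(ℂ, A.model) S x) ∧ (∃ T : Set A.carrier, Sg ⊆ T ∧ (Literature.Geometry.Kaehler.IsAnalyticSet 𝓘(ℂ, A.model) T ∧ ∀ x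 ∈ Literature.Geometry.Kaehler.regularLocus 𝓘(ℂ, A.model) T, ∀ q : ℕ, Literature.Geometry.Kaehler.IsRegularPointOfCodim 𝓘(ℂ, A.model) T q x → p + 1 ≤ q)) ∧ (∀ x ∈ S \ Sg, ∃ U : Set A.carrier, IsOpen U ∧ x ∈ U ∧ ∃ f : A.carrier → (Fin (2 * p) → ℝ), ContMDiffOn 𝓘(ℝ, A.model) 𝓘(ℝ, Fin (2 * p) → ℝ) 1 f U ∧ S ∩ U = U ∩ f ⁻¹' {0} ∧ Function.Surjective (mfderiv 𝓘(ℝ, A.model) 𝓘(ℝ, Fin (2 * p) → ℝ) f x) ∧ ∀ v : TangentSpace 𝓘(ℝ, A.model) x, mfderiv 𝓘(ℝ, A.model) 𝓘(ℝ, Fin (2 * p) → ℝ) f x v = 0 → mfderiv 𝓘(ℝ, A.model) 𝓘(ℝ, Fin (2 * p) → ℝ) f x (Literature.Geometry.Kaehler.tangentJ A.model x v) = 0)) ∧ Literature.AlgebraicTopology.SingularHomology.singularCohomology.map ℂ ℂ (⟨Subtype.val, continuous_subtype_val⟩ : C({x : A.carrier // x ∉ S}, A.carrier)) (2 * p) (A.pullback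 (2 * p) (((m : ℂ) • c + ((a k : ℕ) : ℂ) • hp))) = 0 :=
  fun n p X hX _hpn hp0 _hpn' => newtonBelowThreshold_mid_at_of_hodgeFor n p X hX hp0
    (fun A r hr hrpp => hodgeFor_of_hodgeConjecture hHC hX A r hr hrpp)

/-! ### The line's assembly, pointwise in `(n, p, X)` -/

/-- **Edge + mid ⟹ the correction statement at `(n, p, X)`**: the eventual-correction statement of the line
(`stub_newtonBelowThreshold` of the skeleton) at `(n, p, X)` follows from its middle-codimension case
(`0 < p < n`, hypothesis `hmid`) — the edge codimensions `p = 0`, `p = n` are automatic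
(`stub_newtonBelowThreshold_edge`). [folklore] -/
theorem newtonBelowThreshold_at_of_mid_at (n p : ℕ) (X : Literature.AlgebraicGeometry.Motives.SchemeOver ℂ)
    (hX : Literature.AlgebraicGeometry.Motives.IsSmoothProjective n X) (hpn : p ≤ n)
    (hmid : 0 < p → p < n → ∀ (A : Literature.AlgebraicGeometry.HodgeTheory.HodgeModel n X) (g : Bundle.ContMDiffRiemannianMetric 𝓘(ℝ, A.model) ((⊤ : ℕ∞) : WithTop ℕ∞) A.model (fun x : A.carrier => TangentSpace 𝓘(ℝ, A.model) x)) (c hp : Literature.AlgebraicGeometry.HodgeTheory.complexBetti X (2 * p)) (m : ℕ) (C : ℝ) (a : ℕ → ℕ) (t : ℕ → ℝ), Literature.AlgebraicGeometry.HodgeTheory.IsRationalClass hp → hp ∈ Literature.AlgebraicGeometry.HodgeTheory.algebraicClasses X p → 0 < m → (∀ k, (a k : ℝ) ≤ C * (k : ℝ) ^ p) → Filter.Tendsto (fun k : ℕ => t k * (k : ℝ) ^ p) Filter.atTop (nhds 0) → A.pullback (2 * p) c ∈ A.hodgePQ (2 * p) p p → ∀ᶠ k : ℕ in Filter.atTop,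 (∃ S Sg : Set A.carrier, (IsClosed S ∧ IsClosed Sg ∧ Sg ⊆ S ∧ IsConnected (S \ Sg) ∧ (∀ x ∈ Sg, Literature.Geometry.Kaehler.IsAnalyticSetAt 𝓘(ℂ, A.model) S x) ∧ (∃ T : Set A.carrier, Sg ⊆ T ∧ (Literature.Geometry.Kaehler.IsAnalyticSet 𝓘(ℂ, A.model) T ∧ ∀ x ∈ Literature.Geometry.Kaehler.regularLocus 𝓘(ℂ, A.model) T, ∀ q : ℕ, Literature.Geometry.Kaehler.IsRegularPointOfCodim 𝓘(ℂ, A.model) T q x → p + 1 ≤ q)) ∧ (∀ x ∈ S \ Sg, ∃ U : Set A.carrier, IsOpen U ∧ x ∈ U ∧ ∃ f : A.carrier → (Fin (2 * p) → ℝ), ContMDiffOn 𝓘(ℝ, A.model) 𝓘(ℝ, Fin (2 * p) → ℝ) 1 f U ∧ S ∩ U = U ∩ f ⁻¹' {0} ∧ Function.Surjective (mfderiv 𝓘(ℝ, A.model) 𝓘(ℝ, Fin (2 * p) → ℝ) f x) ∧ ∀ v : TangentSpace 𝓘(ℝ, A.model) x, mfderiv 𝓘(ℝ, A.model) 𝓘(ℝ,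 Fin (2 * p) → ℝ) f x v = 0 → ∃ w : TangentSpace 𝓘(ℝ, A.model) x, mfderiv 𝓘(ℝ, A.model) 𝓘(ℝ, Fin (2 * p) → ℝ) f x w = 0 ∧ g.inner x (Literature.Geometry.Kaehler.tangentJ A.model x v - w) (Literature.Geometry.Kaehler.tangentJ A.model x v - w) ≤ (t k) ^ 2 * g.inner x v v)) ∧ Literature.AlgebraicTopology.SingularHomology.singularCohomology.map ℂ ℂ (⟨Subtype.val, continuous_subtype_val⟩ : C({x : A.carrier // x ∉ S}, A.carrier)) (2 * p) (A.pullback (2 * p) (((m : ℂ) • c + ((a k : ℕ) : ℂ) • hp))) = 0) → ∃ S Sg : Set A.carrier, (IsClosed S ∧ IsClosed Sg ∧ Sg ⊆ S ∧ (∀ x ∈ Sg, Literature.Geometry.Kaehler.IsAnalyticSetAt 𝓘(ℂ, A.model) S x) ∧ (∃ T : Set A.carrier, Sg ⊆ T ∧ (Literature.Geometry.Kaehler.IsAnalyticSet 𝓘(ℂ, A.model) T ∧ ∀ x ∈ Literature.Geometry.Kaehler.regularLocus 𝓘(ℂ, A.model) T, ∀ q : ℕ, Literature.Geometry.Kaehler.IsRegularPointOfCodim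 𝓘(ℂ, A.model) T q x → p + 1 ≤ q)) ∧ (∀ x ∈ S \ Sg, ∃ U : Set A.carrier, IsOpen U ∧ x ∈ U ∧ ∃ f : A.carrier → (Fin (2 * p) → ℝ), ContMDiffOn 𝓘(ℝ, A.model) 𝓘(ℝ, Fin (2 * p) → ℝ) 1 f U ∧ S ∩ U = U ∩ f ⁻¹' {0} ∧ Function.Surjective (mfderiv 𝓘(ℝ, A.model) 𝓘(ℝ, Fin (2 * p) → ℝ) f x) ∧ ∀ v : TangentSpace 𝓘(ℝ, A.model) x, mfderiv 𝓘(ℝ, A.model) 𝓘(ℝ, Fin (2 * p) → ℝ) f x v = 0 → mfderiv 𝓘(ℝ, A.model) 𝓘(ℝ, Fin (2 * p) → ℝ) f x (Literature.Geometry.Kaehler.tangentJ A.model x v) = 0)) ∧ Literature.AlgebraicTopology.SingularHomology.singularCohomology.map ℂ ℂ (⟨Subtype.val, continuous_subtype_val⟩ : C({x : A.carrier // x ∉ S}, A.carrier)) (2 * p) (A.pullback (2 * p) (((m : ℂ) • c + ((a k : ℕ) : ℂ) • hp))) = 0) :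
    ∀ (A : Literature.AlgebraicGeometry.HodgeTheory.HodgeModel n X) (g : Bundle.ContMDiffRiemannianMetric 𝓘(ℝ, A.model) ((⊤ : ℕ∞) : WithTop ℕ∞) A.model (fun x : A.carrier => TangentSpace 𝓘(ℝ, A.model) x)) (c hp : Literature.AlgebraicGeometry.HodgeTheory.complexBetti X (2 * p)) (m : ℕ) (C : ℝ) (a : ℕ → ℕ) (t : ℕ → ℝ), Literature.AlgebraicGeometry.HodgeTheory.IsRationalClass hp → hp ∈ Literature.AlgebraicGeometry.HodgeTheory.algebraicClasses X p → 0 < m → (∀ k, (a k : ℝ) ≤ C * (k : ℝ) ^ p) → Filter.Tendsto (fun k : ℕ => t k * (k : ℝ) ^ p) Filter.atTop (nhds 0) → A.pullback (2 * p) c ∈ A.hodgePQ (2 * p) p p → ∀ᶠ k : ℕ in Filter.atTop, (∃ S Sg : Set A.carrier, (IsClosed S ∧ IsClosed Sg ∧ Sg ⊆ S ∧ IsConnected (S \ Sg) ∧ (∀ x ∈ Sg, Literature.Geometry.Kaehler.IsAnalyticSetAt 𝓘(ℂ, A.model) S x) ∧ (∃ T : Set A.carrier, Sg ⊆ T ∧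 (Literature.Geometry.Kaehler.IsAnalyticSet 𝓘(ℂ, A.model) T ∧ ∀ x ∈ Literature.Geometry.Kaehler.regularLocus 𝓘(ℂ, A.model) T, ∀ q : ℕ, Literature.Geometry.Kaehler.IsRegularPointOfCodim 𝓘(ℂ, A.model) T q x → p + 1 ≤ q)) ∧ (∀ x ∈ S \ Sg, ∃ U : Set A.carrier, IsOpen U ∧ x ∈ U ∧ ∃ f : A.carrier → (Fin (2 * p) → ℝ), ContMDiffOn 𝓘(ℝ, A.model) 𝓘(ℝ, Fin (2 * p) → ℝ) 1 f U ∧ S ∩ U = U ∩ f ⁻¹' {0} ∧ Function.Surjective (mfderiv 𝓘(ℝ, A.model) 𝓘(ℝ, Fin (2 * p) → ℝ) f x) ∧ ∀ v : TangentSpace 𝓘(ℝ, A.model) x, mfderiv 𝓘(ℝ, A.model) 𝓘(ℝ, Fin (2 * p) → ℝ) f x v = 0 → ∃ w : TangentSpace 𝓘(ℝ, A.model) x, mfderiv 𝓘(ℝ, A.model) 𝓘(ℝ, Fin (2 * p) → ℝ) f x w = 0 ∧ g.inner x (Literature.Geometry.Kaehler.tangentJ A.model x v - w) (Literature.Geometry.Kaehler.tangentJ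 A.model x v - w) ≤ (t k) ^ 2 * g.inner x v v)) ∧ Literature.AlgebraicTopology.SingularHomology.singularCohomology.map ℂ ℂ (⟨Subtype.val, continuous_subtype_val⟩ : C({x : A.carrier // x ∉ S}, A.carrier)) (2 * p) (A.pullback (2 * p) (((m : ℂ) • c + ((a k : ℕ) : ℂ) • hp))) = 0) → ∃ S Sg : Set A.carrier, (IsClosed S ∧ IsClosed Sg ∧ Sg ⊆ S ∧ (∀ x ∈ Sg, Literature.Geometry.Kaehler.IsAnalyticSetAt 𝓘(ℂ, A.model) S x) ∧ (∃ T : Set A.carrier, Sg ⊆ T ∧ (Literature.Geometry.Kaehler.IsAnalyticSet 𝓘(ℂ, A.model) T ∧ ∀ x ∈ Literature.Geometry.Kaehler.regularLocus 𝓘(ℂ, A.model) T, ∀ q : ℕ, Literature.Geometry.Kaehler.IsRegularPointOfCodim 𝓘(ℂ, A.model) T q x → p + 1 ≤ q)) ∧ (∀ x ∈ S \ Sg, ∃ U : Set A.carrier, IsOpen U ∧ x ∈ U ∧ ∃ f : A.carrier → (Fin (2 * p) → ℝ), ContMDiffOn 𝓘(ℝ, A.model) 𝓘(ℝ, Fin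 (2 * p) → ℝ) 1 f U ∧ S ∩ U = U ∩ f ⁻¹' {0} ∧ Function.Surjective (mfderiv 𝓘(ℝ, A.model) 𝓘(ℝ, Fin (2 * p) → ℝ) f x) ∧ ∀ v : TangentSpace 𝓘(ℝ, A.model) x, mfderiv 𝓘(ℝ, A.model) 𝓘(ℝ, Fin (2 * p) → ℝ) f x v = 0 → mfderiv 𝓘(ℝ, A.model) 𝓘(ℝ, Fin (2 * p) → ℝ) f x (Literature.Geometry.Kaehler.tangentJ A.model x v) = 0)) ∧ Literature.AlgebraicTopology.SingularHomology.singularCohomology.map ℂ ℂ (⟨Subtype.val, continuous_subtype_val⟩ : C({x : A.carrier // x ∉ S}, A.carrier)) (2 * p) (A.pullback (2 * p) (((m : ℂ) • c + ((a k : ℕ) : ℂ) • hp))) = 0 := by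
  by_cases h : p = 0 ∨ p = n
  · exact stub_newtonBelowThreshold_edge n p X hX hpn h
  · have h' : p ≠ 0 ∧ p ≠ n := not_or.1 h
    exact hmid (Nat.pos_of_ne_zero h'.1) (lt_of_le_of_ne hpn h'.2)

/-- **The crux at `(n, p, X)` from E2 and the mid statement at `(n, p, X)`** (the skeleton's assembly
`SuperThresholdRigidity_of`, pointwise): with the crux's defect profile `t_k := C'·k^{-(p+δ)}` one has
`t_k·k^p = C'·k^{-δ} → 0`, so E2 (`ThresholdForcesHodgeType`, route item, hypothesis by name) makes `c` of type
`(p,p)`; `newtonBelowThreshold_at_of_mid_at` corrects, for all large `k`, every super-threshold representative;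
`Frequently.and_eventually` picks one `k`; `stub_holomorphicSupportIsAnalytic` recognises the corrected support as
a closed analytic subset with regular points of codimension `≥ p`. [cite: VoisinHodgeI2002, §11.1.2 and §11.3] -/
theorem superThresholdRigidity_at_of_mid_at (hE2 : ThresholdForcesHodgeType) (n p : ℕ)
    (X : Literature.AlgebraicGeometry.Motives.SchemeOver ℂ)
    (hX : Literature.AlgebraicGeometry.Motives.IsSmoothProjective n X) (hpn : p ≤ n)
    (hmid : 0 < p → p < n → ∀ (A : Literature.AlgebraicGeometry.HodgeTheory.HodgeModel n X) (g : Bundle.ContMDiffRiemannianMetric 𝓘(ℝ, A.model) ((⊤ : ℕ∞) : WithTop ℕ∞) A.model (fun x : A.carrier => TangentSpace 𝓘(ℝ, A.model) x)) (c hp : Literature.AlgebraicGeometry.HodgeTheory.complexBetti X (2 * p)) (m : ℕ) (C : ℝ) (a : ℕ → ℕ) (t : ℕ → ℝ), Literature.AlgebraicGeometry.HodgeTheory.IsRationalClass hp → hp ∈ Literature.AlgebraicGeometry.HodgeTheory.algebraicClasses X p → 0 < m → (∀ k, (a k : ℝ) ≤ C * (k : ℝ) ^ p) → Filter.Tendsto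 (fun k : ℕ => t k * (k : ℝ) ^ p) Filter.atTop (nhds 0) → A.pullback (2 * p) c ∈ A.hodgePQ (2 * p) p p → ∀ᶠ k : ℕ in Filter.atTop, (∃ S Sg : Set A.carrier, (IsClosed S ∧ IsClosed Sg ∧ Sg ⊆ S ∧ IsConnected (S \ Sg) ∧ (∀ x ∈ Sg, Literature.Geometry.Kaehler.IsAnalyticSetAt 𝓘(ℂ, A.model) S x) ∧ (∃ T : Set A.carrier, Sg ⊆ T ∧ (Literature.Geometry.Kaehler.IsAnalyticSet 𝓘(ℂ, A.model) T ∧ ∀ x ∈ Literature.Geometry.Kaehler.regularLocus 𝓘(ℂ, A.model) T, ∀ q : ℕ, Literature.Geometry.Kaehler.IsRegularPointOfCodim 𝓘(ℂ, A.model) T q x → p + 1 ≤ q)) ∧ (∀ x ∈ S \ Sg, ∃ U : Set A.carrier, IsOpen U ∧ x ∈ U ∧ ∃ f : A.carrier → (Fin (2 * p) → ℝ), ContMDiffOn 𝓘(ℝ, A.model) 𝓘(ℝ, Fin (2 * p) → ℝ) 1 f U ∧ S ∩ U = U ∩ f ⁻¹' {0} ∧ Function.Surjective (mfderiv 𝓘(ℝ,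 A.model) 𝓘(ℝ, Fin (2 * p) → ℝ) f x) ∧ ∀ v : TangentSpace 𝓘(ℝ, A.model) x, mfderiv 𝓘(ℝ, A.model) 𝓘(ℝ, Fin (2 * p) → ℝ) f x v = 0 → ∃ w : TangentSpace 𝓘(ℝ, A.model) x, mfderiv 𝓘(ℝ, A.model) 𝓘(ℝ, Fin (2 * p) → ℝ) f x w = 0 ∧ g.inner x (Literature.Geometry.Kaehler.tangentJ A.model x v - w) (Literature.Geometry.Kaehler.tangentJ A.model x v - w) ≤ (t k) ^ 2 * g.inner x v v)) ∧ Literature.AlgebraicTopology.SingularHomology.singularCohomology.map ℂ ℂ (⟨Subtype.val, continuous_subtype_val⟩ : C({x : A.carrier // x ∉ S}, A.carrier)) (2 * p) (A.pullback (2 * p) (((m : ℂ) • c + ((a k : ℕ) : ℂ) • hp))) = 0) → ∃ S Sg : Set A.carrier, (IsClosed S ∧ IsClosed Sg ∧ Sg ⊆ S ∧ (∀ x ∈ Sg, Literature.Geometry.Kaehler.IsAnalyticSetAt 𝓘(ℂ, A.model) S x) ∧ (∃ T : Set A.carrier, Sg ⊆ T ∧ (Literature.Geometry.Kaehler.IsAnalyticSet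 𝓘(ℂ, A.model) T ∧ ∀ x ∈ Literature.Geometry.Kaehler.regularLocus 𝓘(ℂ, A.model) T, ∀ q : ℕ, Literature.Geometry.Kaehler.IsRegularPointOfCodim 𝓘(ℂ, A.model) T q x → p + 1 ≤ q)) ∧ (∀ x ∈ S \ Sg, ∃ U : Set A.carrier, IsOpen U ∧ x ∈ U ∧ ∃ f : A.carrier → (Fin (2 * p) → ℝ), ContMDiffOn 𝓘(ℝ, A.model) 𝓘(ℝ, Fin (2 * p) → ℝ) 1 f U ∧ S ∩ U = U ∩ f ⁻¹' {0} ∧ Function.Surjective (mfderiv 𝓘(ℝ, A.model) 𝓘(ℝ, Fin (2 * p) → ℝ) f x) ∧ ∀ v : TangentSpace 𝓘(ℝ, A.model) x, mfderiv 𝓘(ℝ, A.model) 𝓘(ℝ, Fin (2 * p) → ℝ) f x v = 0 → mfderiv 𝓘(ℝ, A.model) 𝓘(ℝ, Fin (2 * p) → ℝ) f x (Literature.Geometry.Kaehler.tangentJ A.model x v) = 0)) ∧ Literature.AlgebraicTopology.SingularHomology.singularCohomology.map ℂ ℂ (⟨Subtype.val, continuous_subtype_val⟩ : C({x : A.carrier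 // x ∉ S}, A.carrier)) (2 * p) (A.pullback (2 * p) (((m : ℂ) • c + ((a k : ℕ) : ℂ) • hp))) = 0) :
    ∀ (A : Literature.AlgebraicGeometry.HodgeTheory.HodgeModel n X) (g : Bundle.ContMDiffRiemannianMetric 𝓘(ℝ, A.model) ((⊤ : ℕ∞) : WithTop ℕ∞) A.model (fun x : A.carrier => TangentSpace 𝓘(ℝ, A.model) x)) (c hp : Literature.AlgebraicGeometry.HodgeTheory.complexBetti X (2 * p)) (m : ℕ) (C : ℝ) (a : ℕ → ℕ) (δ C' : ℝ), Literature.AlgebraicGeometry.HodgeTheory.IsRationalClass hp → hp ∈ Literature.AlgebraicGeometry.HodgeTheory.algebraicClasses X p → 0 < m → (∀ k, (a k : ℝ) ≤ C * (k : ℝ) ^ p) → 0 < δ → (∃ᶠ k : ℕ in Filter.atTop, ∃ S Sg : Set A.carrier, (IsClosed S ∧ IsClosed Sg ∧ Sg ⊆ S ∧ IsConnected (S \ Sg) ∧ (∀ x ∈ Sg, Literature.Geometry.Kaehler.IsAnalyticSetAt 𝓘(ℂ, A.model) S x) ∧ (∃ T : Set A.carrier, Sg ⊆ T ∧ (Literature.Geometry.Kaehler.IsAnalyticSet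 𝓘(ℂ, A.model) T ∧ ∀ x ∈ Literature.Geometry.Kaehler.regularLocus 𝓘(ℂ, A.model) T, ∀ q : ℕ, Literature.Geometry.Kaehler.IsRegularPointOfCodim 𝓘(ℂ, A.model) T q x → p + 1 ≤ q)) ∧ (∀ x ∈ S \ Sg, ∃ U : Set A.carrier, IsOpen U ∧ x ∈ U ∧ ∃ f : A.carrier → (Fin (2 * p) → ℝ), ContMDiffOn 𝓘(ℝ, A.model) 𝓘(ℝ, Fin (2 * p) → ℝ) 1 f U ∧ S ∩ U = U ∩ f ⁻¹' {0} ∧ Function.Surjective (mfderiv 𝓘(ℝ, A.model) 𝓘(ℝ, Fin (2 * p) → ℝ) f x) ∧ ∀ v : TangentSpace 𝓘(ℝ, A.model) x, mfderiv 𝓘(ℝ, A.model) 𝓘(ℝ, Fin (2 * p) → ℝ) f x v = 0 → ∃ w : TangentSpace 𝓘(ℝ, A.model) x, mfderiv 𝓘(ℝ, A.model) 𝓘(ℝ, Fin (2 * p) → ℝ) f x w = 0 ∧ g.inner x (Literature.Geometry.Kaehler.tangentJ A.model x v - w) (Literature.Geometry.Kaehler.tangentJ A.model x v - w) ≤ (C'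 * (k : ℝ) ^ (-((p : ℝ) + δ))) ^ 2 * g.inner x v v)) ∧ Literature.AlgebraicTopology.SingularHomology.singularCohomology.map ℂ ℂ (⟨Subtype.val, continuous_subtype_val⟩ : C({x : A.carrier // x ∉ S}, A.carrier)) (2 * p) (A.pullback (2 * p) (((m : ℂ) • c + ((a k : ℕ) : ℂ) • hp))) = 0) → ∃ (k : ℕ) (S : Set A.carrier), (Literature.Geometry.Kaehler.IsAnalyticSet 𝓘(ℂ, A.model) S ∧ ∀ x ∈ Literature.Geometry.Kaehler.regularLocus 𝓘(ℂ, A.model) S, ∀ q : ℕ, Literature.Geometry.Kaehler.IsRegularPointOfCodim 𝓘(ℂ, A.model) S q x → p ≤ q) ∧ Literature.AlgebraicTopology.SingularHomology.singularCohomology.map ℂ ℂ (⟨Subtype.val, continuous_subtype_val⟩ : C({x : A.carrier // x ∉ S}, A.carrier)) (2 * p) (A.pullback (2 * p) (((m : ℂ) • c + ((a k : ℕ) : ℂ) • hp))) = 0 := by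
  intro A g c hp m C a δ C' hrat halg hm hbud hδ hfreq
  -- the defect profile of the crux and its rate: `t_k · k^p = C' · k^{-δ} → 0`
  have htend : Filter.Tendsto (fun k : ℕ => C' * (k : ℝ) ^ (-((p : ℝ) + δ)) * (k : ℝ) ^ p)
      Filter.atTop (nhds 0) := by
    have h1 : Filter.Tendsto (fun k : ℕ => C' * (k : ℝ) ^ (-δ)) Filter.atTop (nhds 0) := by
      have h0 := ((tendsto_rpow_neg_atTop hδ).comp tendsto_natCast_atTop_atTop).const_mul C'
      simpa using h0
    refine h1.congr' ?_
    filter_upwards [Filter.eventually_gt_atTop 0] with k hk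
    have hk' : (k : ℝ) ≠ 0 := Nat.cast_ne_zero.2 (Nat.pos_iff_ne_zero.1 hk)
    have e : (k : ℝ) ^ (-((p : ℝ) + δ)) * (k : ℝ) ^ p = (k : ℝ) ^ (-δ) := by
      rw [← Real.rpow_add_natCast hk', show -((p : ℝ) + δ) + (p : ℕ) = -δ by ring]
    simp only [mul_assoc, e]
  -- E2: super-threshold representatives for infinitely many `k` force the Hodge type of `c`
  have hH : A.pullback (2 * p) c ∈ A.hodgePQ (2 * p) p p :=
    hE2 n p X hX hpn A g c hp m C a (fun k : ℕ => C' * (k : ℝ) ^ (-((p : ℝ) + δ)))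
      hrat halg hm hbud htend hfreq
  -- eventually every super-threshold representative is correctable
  have hev := newtonBelowThreshold_at_of_mid_at n p X hX hpn hmid A g c hp m C a
    (fun k : ℕ => C' * (k : ℝ) ^ (-((p : ℝ) + δ))) hrat halg hm hbud htend hH
  -- one `k` carrying both a super-threshold representative and its correction
  obtain ⟨k, hk, hcorr⟩ := (hfreq.and_eventually hev).exists
  obtain ⟨S, Sg, hhol, hsupp⟩ := hcorr hk
  -- recognition: the corrected support is a closed analytic subset with regular points of codim ≥ p
  exact ⟨k, S, stub_holomorphicSupportIsAnalytic n X A p S Sg hhol, hsupp⟩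

/-! ### The crux from E2 and the Hodge core; the crux outright for `p ∈ {1, n - 1}` and for `n ≤ 3` -/

/-- **E2 ∧ (Hodge conjecture at or below the middle) ⟹ the crux `SuperThresholdRigidity`** (route decl by name).
The residual open content of line `registered` is exactly its stub `stub_hodgeBelowMiddle` (HC for `2 ≤ p ≤ n/2`,
shared with `RateGap`): compare `rateGap_of_hodgeBelowMiddle` (R1 ⟸ the same core) and the route's `closes`
(R1 ∧ R2 ⟹ HC). [cite: VoisinHodgeI2002, §11.1.2 and §11.3] [cite: KerrPearlstein2011, §3.1] -/
theorem superThresholdRigidity_of_hodgeBelowMiddle (hE2 : ThresholdForcesHodgeType)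
    (hH : ∀ (n p : ℕ) (X : Literature.AlgebraicGeometry.Motives.SchemeOver ℂ), Literature.AlgebraicGeometry.Motives.IsSmoothProjective n X → 2 ≤ p → 2 * p ≤ n → ∀ (A : Literature.AlgebraicGeometry.HodgeTheory.HodgeModel n X) (c : Literature.AlgebraicGeometry.HodgeTheory.complexBetti X (2 * p)), Literature.AlgebraicGeometry.HodgeTheory.IsRationalClass c → A.pullback (2 * p) c ∈ A.hodgePQ (2 * p) p p → c ∈ Literature.AlgebraicGeometry.HodgeTheory.algebraicClasses X p) :
    SuperThresholdRigidity := by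
  intro n p X hX hpn
  exact superThresholdRigidity_at_of_mid_at hE2 n p X hX hpn
    (fun hp0 hpn' => newtonBelowThreshold_mid_of_hodgeBelowMiddle hH n p X hX hpn hp0 hpn')

/-- **E2 ∧ HC ⟹ the crux `SuperThresholdRigidity`** (the summit statement feeds the Hodge core; with the route's
deciding theorem `closes : RateGap → SuperThresholdRigidity → … → HodgeConjecture` and `rateGap_of_hodgeConjecture`,
both cruxes are pinned between E2 ∧ HC and HC). [cite: Deligne2000, §1] -/
theorem superThresholdRigidity_of_hodgeConjecture (hE2 : ThresholdForcesHodgeType) (hHC : _root_.HodgeConjecture) :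
    SuperThresholdRigidity :=
  superThresholdRigidity_of_hodgeBelowMiddle hE2 fun _ p _ hX _ _ A c hc hpp => (hHC hX).2 p c hc ⟨A, hpp⟩

/-- **The crux at `(n, p, X)` for `p = 1` or `p = n - 1`, granted E2 only** (no Hodge conjecture: Lefschetz `(1,1)`
and hard Lefschetz are theorems of the tree). The statement is the body of `SuperThresholdRigidity` at `(n, p, X)`
with the extra hypothesis `p = 1 ∨ p + 1 = n`. [cite: VoisinHodgeI2002, Thm. 6.25, Thm. 11.30 and §11.1.2] -/
theorem superThresholdRigidity_at_of_eq_one_or_succ_eq (hE2 : ThresholdForcesHodgeType) : ∀ (n p : ℕ) (X : Literature.AlgebraicGeometry.Motives.SchemeOver ℂ), Literature.AlgebraicGeometry.Motives.IsSmoothProjective n X → p ≤ n → (p = 1 ∨ p + 1 = n) → ∀ (A : Literature.AlgebraicGeometry.HodgeTheory.HodgeModel n X) (g : Bundle.ContMDiffRiemannianMetric 𝓘(ℝ, A.model) ((⊤ : ℕ∞) : WithTop ℕ∞) A.model (fun x : A.carrier => TangentSpace 𝓘(ℝ, A.model) x)) (c hp : Literature.AlgebraicGeometry.HodgeTheory.complexBetti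 X (2 * p)) (m : ℕ) (C : ℝ) (a : ℕ → ℕ) (δ C' : ℝ), Literature.AlgebraicGeometry.HodgeTheory.IsRationalClass hp → hp ∈ Literature.AlgebraicGeometry.HodgeTheory.algebraicClasses X p → 0 < m → (∀ k, (a k : ℝ) ≤ C * (k : ℝ) ^ p) → 0 < δ → (∃ᶠ k : ℕ in Filter.atTop, ∃ S Sg : Set A.carrier, (IsClosed S ∧ IsClosed Sg ∧ Sg ⊆ S ∧ IsConnected (S \ Sg) ∧ (∀ x ∈ Sg, Literature.Geometry.Kaehler.IsAnalyticSetAt 𝓘(ℂ, A.model) S x) ∧ (∃ T : Set A.carrier, Sg ⊆ T ∧ (Literature.Geometry.Kaehler.IsAnalyticSet 𝓘(ℂ, A.model) T ∧ ∀ x ∈ Literature.Geometry.Kaehler.regularLocus 𝓘(ℂ, A.model) T, ∀ q : ℕ, Literature.Geometry.Kaehler.IsRegularPointOfCodim 𝓘(ℂ, A.model) T q x → p + 1 ≤ q)) ∧ (∀ x ∈ S \ Sg, ∃ U : Set A.carrier, IsOpen U ∧ x ∈ U ∧ ∃ f : A.carrier → (Fin (2 * p) → ℝ), ContMDiffOn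 𝓘(ℝ, A.model) 𝓘(ℝ, Fin (2 * p) → ℝ) 1 f U ∧ S ∩ U = U ∩ f ⁻¹' {0} ∧ Function.Surjective (mfderiv 𝓘(ℝ, A.model) 𝓘(ℝ, Fin (2 * p) → ℝ) f x) ∧ ∀ v : TangentSpace 𝓘(ℝ, A.model) x, mfderiv 𝓘(ℝ, A.model) 𝓘(ℝ, Fin (2 * p) → ℝ) f x v = 0 → ∃ w : TangentSpace 𝓘(ℝ, A.model) x, mfderiv 𝓘(ℝ, A.model) 𝓘(ℝ, Fin (2 * p) → ℝ) f x w = 0 ∧ g.inner x (Literature.Geometry.Kaehler.tangentJ A.model x v - w) (Literature.Geometry.Kaehler.tangentJ A.model x v - w) ≤ (C' * (k : ℝ) ^ (-((p : ℝ) + δ))) ^ 2 * g.inner x v v)) ∧ Literature.AlgebraicTopology.SingularHomology.singularCohomology.map ℂ ℂ (⟨Subtype.val, continuous_subtype_val⟩ : C({x : A.carrier // x ∉ S}, A.carrier)) (2 * p) (A.pullback (2 * p) (((m : ℂ) • c + ((a k : ℕ) : ℂ) • hp))) = 0) → ∃ (k : ℕ) (S : Set A.carrier), (Literature.Geometry.Kaehler.IsAnalyticSet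 𝓘(ℂ, A.model) S ∧ ∀ x ∈ Literature.Geometry.Kaehler.regularLocus 𝓘(ℂ, A.model) S, ∀ q : ℕ, Literature.Geometry.Kaehler.IsRegularPointOfCodim 𝓘(ℂ, A.model) S q x → p ≤ q) ∧ Literature.AlgebraicTopology.SingularHomology.singularCohomology.map ℂ ℂ (⟨Subtype.val, continuous_subtype_val⟩ : C({x : A.carrier // x ∉ S}, A.carrier)) (2 * p) (A.pullback (2 * p) (((m : ℂ) • c + ((a k : ℕ) : ℂ) • hp))) = 0 :=
  fun n p X hX hpn hp => superThresholdRigidity_at_of_mid_at hE2 n p X hX hpn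
    (fun hp0 hpn' => newtonBelowThreshold_mid_of_eq_one_or_succ_eq n p X hX hpn hp0 hpn' hp)

/-- **The crux for every `n ≤ 3`, granted E2 only**: for `0 < p < n ≤ 3` one has `p = 1` or `p + 1 = n`, and the
edge codimensions are automatic. The statement is `SuperThresholdRigidity` with its leading `∀ n p X …` restricted by
`n ≤ 3`. [cite: VoisinHodgeI2002, Thm. 6.25, Thm. 11.30 and §11.1.2] -/
theorem superThresholdRigidity_of_le_three (hE2 : ThresholdForcesHodgeType) : ∀ (n p : ℕ) (X : Literature.AlgebraicGeometry.Motives.SchemeOver ℂ), Literature.AlgebraicGeometry.Motives.IsSmoothProjective n X → p ≤ n → n ≤ 3 → ∀ (A : Literature.AlgebraicGeometry.HodgeTheory.HodgeModel n X) (g : Bundle.ContMDiffRiemannianMetric 𝓘(ℝ, A.model) ((⊤ : ℕ∞) : WithTop ℕ∞) A.model (fun x : A.carrier => TangentSpace 𝓘(ℝ, A.model) x)) (c hp : Literature.AlgebraicGeometry.HodgeTheory.complexBetti X (2 * p)) (m : ℕ) (C : ℝ) (a : ℕ → ℕ) (δ C' : ℝ), Literature.AlgebraicGeometry.HodgeTheory.IsRationalClass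 hp → hp ∈ Literature.AlgebraicGeometry.HodgeTheory.algebraicClasses X p → 0 < m → (∀ k, (a k : ℝ) ≤ C * (k : ℝ) ^ p) → 0 < δ → (∃ᶠ k : ℕ in Filter.atTop, ∃ S Sg : Set A.carrier, (IsClosed S ∧ IsClosed Sg ∧ Sg ⊆ S ∧ IsConnected (S \ Sg) ∧ (∀ x ∈ Sg, Literature.Geometry.Kaehler.IsAnalyticSetAt 𝓘(ℂ, A.model) S x) ∧ (∃ T : Set A.carrier, Sg ⊆ T ∧ (Literature.Geometry.Kaehler.IsAnalyticSet 𝓘(ℂ, A.model) T ∧ ∀ x ∈ Literature.Geometry.Kaehler.regularLocus 𝓘(ℂ, A.model) T, ∀ q : ℕ, Literature.Geometry.Kaehler.IsRegularPointOfCodim 𝓘(ℂ, A.model) T q x → p + 1 ≤ q)) ∧ (∀ x ∈ S \ Sg, ∃ U : Set A.carrier, IsOpen U ∧ x ∈ U ∧ ∃ f : A.carrier → (Fin (2 * p) → ℝ), ContMDiffOn 𝓘(ℝ, A.model) 𝓘(ℝ, Fin (2 * p) → ℝ) 1 f U ∧ S ∩ U = U ∩ f ⁻¹' {0} ∧ Function.Surjective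 (mfderiv 𝓘(ℝ, A.model) 𝓘(ℝ, Fin (2 * p) → ℝ) f x) ∧ ∀ v : TangentSpace 𝓘(ℝ, A.model) x, mfderiv 𝓘(ℝ, A.model) 𝓘(ℝ, Fin (2 * p) → ℝ) f x v = 0 → ∃ w : TangentSpace 𝓘(ℝ, A.model) x, mfderiv 𝓘(ℝ, A.model) 𝓘(ℝ, Fin (2 * p) → ℝ) f x w = 0 ∧ g.inner x (Literature.Geometry.Kaehler.tangentJ A.model x v - w) (Literature.Geometry.Kaehler.tangentJ A.model x v - w) ≤ (C' * (k : ℝ) ^ (-((p : ℝ) + δ))) ^ 2 * g.inner x v v)) ∧ Literature.AlgebraicTopology.SingularHomology.singularCohomology.map ℂ ℂ (⟨Subtype.val, continuous_subtype_val⟩ : C({x : A.carrier // x ∉ S}, A.carrier)) (2 * p) (A.pullback (2 * p) (((m : ℂ) • c + ((a k : ℕ) : ℂ) • hp))) = 0) → ∃ (k : ℕ) (S : Set A.carrier), (Literature.Geometry.Kaehler.IsAnalyticSet 𝓘(ℂ, A.model) S ∧ ∀ x ∈ Literature.Geometry.Kaehler.regularLocus 𝓘(ℂ, A.model) S, ∀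 q : ℕ, Literature.Geometry.Kaehler.IsRegularPointOfCodim 𝓘(ℂ, A.model) S q x → p ≤ q) ∧ Literature.AlgebraicTopology.SingularHomology.singularCohomology.map ℂ ℂ (⟨Subtype.val, continuous_subtype_val⟩ : C({x : A.carrier // x ∉ S}, A.carrier)) (2 * p) (A.pullback (2 * p) (((m : ℂ) • c + ((a k : ℕ) : ℂ) • hp))) = 0 :=
  fun n p X hX hpn hn3 => superThresholdRigidity_at_of_mid_at hE2 n p X hX hpn
    (fun hp0 hpn' => newtonBelowThreshold_mid_of_eq_one_or_succ_eq n p X hX hpn hp0 hpn' (by omega))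

end Summit.HodgeConjecture.HodgeConjecture.Theorems

end
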